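import Summits.BirchSwinnertonDyer.BirchSwinnertonDyer.Theorems.ByReductionTypeAtTwoAdditiveReducibleKatoMember
import Summits.BirchSwinnertonDyer.BirchSwinnertonDyer.Theses.ByReductionTypeAtTwo
import HarnessLib

/-!
# K4 crux `AdditiveRankZeroAtTwo` (item 19098): the PARITY side condition of Kato's member door is
# NECESSARY — `ord₂ #Ш_an` is even for every curve on which `BSD₂` holds at analytic rank `0`; a typed
# exactness record (crux ⟹ parity)

Cell `bsd-2adic`, seat `bsd-2adic-addL2x` GEN 12. HONEST FRAMING: closes nothing; a bookkeeping theorem and an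
exactness record (the census kits j306106 / j307312 report `ord₂ #Ш_an` odd on 0 of 578 members — nothing fires);
BSD is not proved by any of this. Theorems only.

The member door (GEN 10 p624850, C2″ of the v2.2 split) has two side conditions; GEN 12 made the first (isogeny-class
torsion) kernel from one good odd prime. The second, `∀ q, #Ш_an = q → Even (ord₂ q)`, cannot be discharged from print —
but it is IMPLIED BY THE CRUX ITSELF: `BSD₂(W)` at analytic rank `0` gives `ord₂ #Ш_an = ord₂ #Ш[2^∞] = ord₂ #Ш`, a square by
Cassels–Tate (Ш finite by Gross–Zagier–Kolyvagin). Hence a single additive curve of analytic rank `0` with ODD `ord₂ #Ш_an`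
would refute `AdditiveRankZeroAtTwo` (and BSD): `even_padicValRat_shaAn_of_additiveRankZeroAtTwo` records the implication
crux ⟹ parity (exactness form; no `¬`-statement is filed).
-/

set_option autoImplicit false
set_option linter.dupNamespace false

noncomputable section

open scoped Classical

namespace Summit.BirchSwinnertonDyer.BirchSwinnertonDyer.Theorems.AddKatoTwo

open WeierstrassCurve Literature.NumberTheory.EllipticCurves
  Literature.NumberTheory.EllipticCurves.Rank1Residual
  Summit.BirchSwinnertonDyer.Rank1Residual
  Literature.NumberTheory.EllipticCurves.Rank1Residual.Typed
  Summit.BirchSwinnertonDyer.BirchSwinnertonDyer.Theses.ByReductionTypeAtTwo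

/-- **`BSD₂` at analytic rank `0` forces `ord₂ #Ш_an` even**: `BSDp W 2` says `ord₂ #Ш_an = ord₂ #Ш[2^∞]`
(Miller's currency), `= ord₂ #Ш` for finite `Ш` (Gross–Zagier–Kolyvagin, `hGZK`), and `#Ш` is a square by the
Cassels–Tate pairing (`hCT`, Silverman X.4.14). [cite: SilvermanAEC2009, Thm. X.4.14] [cite: Miller2011LMS, §1 and Def. 1.1] -/
theorem even_padicValRat_shaAn_of_bsdp_two (hCT : exists_casselsTate_pairing (K := ℚ))
    (hGZK : rank_eq_analyticRank_of_analyticRank_le_one) (W : WeierstrassCurve ℚ) [W.IsElliptic]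
    (hr : W.analyticRank = 0) (h : BSDp W 2) {q : ℚ} (hq : shaAn W = (q : ℂ)) : Even (padicValRat 2 q) := by
  haveI : Fact (Nat.Prime 2) := ⟨Nat.prime_two⟩
  obtain ⟨-, -, q', hq', hv⟩ := h
  have hqq : q' = q := by exact_mod_cast hq'.symm.trans hq
  subst hqq
  have hfin : W.ShaFinite := (hGZK W (by rw [hr]; exact zero_le_one)).2
  haveI : Finite W.sha := hfin
  have hsq : IsSquare W.shaOrder := isSquare_shaOrder_of_casselsTate hCT W hfin
  obtain ⟨a, ha⟩ := O6.even_padicValNat_of_isSquare (p := 2) hsq (W.shaOrder_pos hfin).ne'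
  rw [hv, padicValNat_card_addPrimaryComponent]
  change Even ((padicValNat 2 W.shaOrder : ℕ) : ℤ)
  rw [ha]; push_cast; exact ⟨a, rfl⟩

/-- **The parity side condition of C2″ is implied by the crux** (exactness record, in the style of GEN 11's
`…_of_additiveRankZeroAtTwo` lemmas): granted Cassels–Tate and GZK, `AdditiveRankZeroAtTwo` gives, for every globally
minimal non-CM curve additive at `2` of analytic rank `0`, that `ord₂ #Ш_an` is EVEN — so the second side condition of
Kato's member door (`heven`) costs nothing at the ∀-level, and a single additive analytic-rank-0 class with odd `ord₂ #Ш_an`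
(none in the census) would falsify the crux. [cite: SilvermanAEC2009, Thm. X.4.14] [cite: Miller2011LMS, Def. 1.1] -/
theorem even_padicValRat_shaAn_of_additiveRankZeroAtTwo (hCT : exists_casselsTate_pairing (K := ℚ))
    (hGZK : rank_eq_analyticRank_of_analyticRank_le_one) (hcrux : AdditiveRankZeroAtTwo)
    (W : WeierstrassCurve ℚ) [W.IsElliptic] [W.IsGloballyMinimal] (hcm : ¬ W.HasCM) (hr : W.analyticRank = 0)
    (hadd : haveI : Fact (Nat.Prime 2) := ⟨Nat.prime_two⟩; Addv W 2)
    {q : ℚ} (hq : shaAn W = (q : ℂ)) : Even (padicValRat 2 q) :=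
  even_padicValRat_shaAn_of_bsdp_two hCT hGZK W hr (hcrux W hcm hr hadd) hq

end Summit.BirchSwinnertonDyer.BirchSwinnertonDyer.Theorems.AddKatoTwo

end
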